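import Mathlib.FieldTheory.IsAlgClosed.AlgebraicClosure
import Summits.ResolutionOfSingularities.ResolutionOfSingularities.Theorems.WeightedInvariantWeightedConstructionPreDatumReduction
import Summits.ResolutionOfSingularities.ResolutionOfSingularities.Theorems.WeightedInvariantWeightedConstructionWeightedChartRestrict
import Summits.ResolutionOfSingularities.ResolutionOfSingularities.Theorems.WeightedInvariantWeightedConstructionSingularLocusComap
import Summits.ResolutionOfSingularities.ResolutionOfSingularities.Theorems.WeightedInvariantWeightedConstructionExtReesBaseChange
import Summits.ResolutionOfSingularities.ResolutionOfSingularities.Theorems.WeightedInvariantWeightedConstructionCobordantPlusBaseChange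

/-!
# Algebraically-closed chart pre-data: the drop need only be checked over `k̄`, on charts, at singular closed
# exceptional points

Route `ResolutionOfSingularities/WeightedInvariant`, crux `WeightedConstruction`
(stmt-ResolutionOfSingularities-0571), line `support-first-weights-second`, registered stub
`stub_acChartPreDatum_toPreDatum_of`.

`ACChartPreDatum p` weakens `ChartPreDatum p` / `PreDatum p` (Theorems/…ChartReduction.lean,
…PreDatumReduction.lean) once more: the drop `(iv)` is demanded only over ALGEBRAICALLY CLOSED ground fields,
only on affine opens carrying a weighted chart `(u, w)` of the centre, only at CLOSED points `b` of the
exceptional divisor of `B₊(U)` at which the strict transform is SINGULAR. We prove (granted the open pieces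
`B₊(D(h)) ↪ B₊(U)`, hypothesis `HB` = the statement of the landed `stub_cobordantPlus_basicOpen_openImmersion`,
kept as a hypothesis only because that module is not yet built on the Lean farm)
`Nonempty (ACChartPreDatum p) → Nonempty (PreDatum p)` keeping `Γ`, `inv`, `centre`:

* `ACChartPreDatum.inv_lt_alg` — charts ⇒ all affine opens over an algebraically closed field, at singular
  closed exceptional points (chart localisation as in …ChartReduction.lean, singularity transported along the
  open immersion by `stub_singularLocus_comap_baseChange` (a));
* `ACChartPreDatum.inv_lt_of_onExceptional` — algebraically closed ⇒ every perfect ground field and singular ⇒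
  every closed exceptional point: at a point where the strict transform is regular or absent `inv` is minimal
  by `(ii)` while the maximum is not; otherwise base-change the whole situation to an algebraic closure `K` of
  `k` (`Y_K = Y ×_k K`, `inv` and the centre are compatible by `(i)`; `B₊(U)_K = B₊(U_K)` with compatible strict
  transforms and exceptional divisors: `stub_cobordantPlus_baseChange` ∘ `stub_extReesAlgebra_baseChange`;
  a closed exceptional point lifts to a closed exceptional point of the compact fibre; singularity is invariant:
  `stub_singularLocus_comap_baseChange` (b));
* `stub_acChartPreDatum_toPreDatum_of` — the registered stub; `ACChartPreDatum.ofPreDatum` — the converse.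
-/

noncomputable section

open CategoryTheory CategoryTheory.Limits AlgebraicGeometry TopologicalSpace
open Literature.AlgebraicGeometry.Resolution

set_option linter.dupNamespace false -- mandated namespace of this single-conjunct summit

namespace Summit.ResolutionOfSingularities.ResolutionOfSingularities.Theorems

/-- An **algebraically-closed chart pre-datum** in characteristic `p`: a `ChartPreDatum p` whose drop axiom
is demanded only over ALGEBRAICALLY CLOSED ground fields, only on affine opens carrying a weighted chart of the
centre, only at CLOSED points `b` of the exceptional divisor of `B₊(U)` at which the strict transform is
SINGULAR (at the other points `inv` is minimal by `(ii)`), with `B₊(U) → Spec k` smooth, separated and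
quasi-compact available. Every chart pre-datum is one; the converse is `ACChartPreDatum.toPreDatum` (base
change of the whole situation to an algebraic closure, functoriality `(i)` of `inv` and of the centre for
ground-field extensions, and the previous reductions). -/
structure ACChartPreDatum (p : ℕ) : Type 1 where
  /-- the value set of the invariant (one for all dimensions) -/
  Γ : Type
  /-- `Γ` is linearly ordered … -/
  [linearOrder : LinearOrder Γ]
  /-- … and well-ordered -/
  [wellFoundedLT : WellFoundedLT Γ]
  /-- the invariant (total) -/
  inv : ∀ ⦃k : Type⦄ [Field k] ⦃Y : Scheme.{0}⦄, (Y ⟶ Spec (.of k)) → Y.IdealSheafData → Y → Γ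
  /-- the weighted centre (total) -/
  centre : ∀ ⦃k : Type⦄ [Field k] ⦃Y : Scheme.{0}⦄, (Y ⟶ Spec (.of k)) → Y.IdealSheafData →
    ReesAlgebraData Y
  /-- `(usc)` -/
  isClosed_superlevel : ∀ ⦃k : Type⦄ [Field k] [CharP k p] [PerfectField k] ⦃Y : Scheme.{0}⦄
    (f : Y ⟶ Spec (.of k)) [Smooth f] [IsSeparated f] [QuasiCompact f] (X : Y.IdealSheafData)
    (γ : Γ), IsClosed {y : Y | γ ≤ inv f X y}
  /-- `(i)` for `inv`, smooth `k`-morphisms -/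
  inv_comap : ∀ ⦃k : Type⦄ [Field k] [CharP k p] [PerfectField k] ⦃Y Y₁ : Scheme.{0}⦄
    (f : Y ⟶ Spec (.of k)) [Smooth f] [IsSeparated f] [QuasiCompact f]
    (f₁ : Y₁ ⟶ Spec (.of k)) [Smooth f₁] [IsSeparated f₁] [QuasiCompact f₁]
    (g : Y₁ ⟶ Y) [Smooth g], g ≫ f = f₁ →
    ∀ (X : Y.IdealSheafData) (y₁ : Y₁), inv f₁ (X.comap g) y₁ = inv f X (g y₁)
  /-- `(i)` for `inv`, perfect ground-field extensions -/
  inv_baseChange : ∀ ⦃k : Type⦄ [Field k] [CharP k p] [PerfectField k]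
    ⦃K : Type⦄ [Field K] [PerfectField K] (φ : k →+* K)
    ⦃Y YK : Scheme.{0}⦄ (f : Y ⟶ Spec (.of k)) [Smooth f] [IsSeparated f] [QuasiCompact f]
    (fK : YK ⟶ Spec (.of K)) (pr : YK ⟶ Y),
    IsPullback pr fK f (Spec.map (CommRingCat.ofHom φ)) →
    ∀ (X : Y.IdealSheafData) (y : YK), inv fK (X.comap pr) y = inv f X (pr y)
  /-- `(ii)` -/
  isBot_inv_iff : ∀ ⦃k : Type⦄ [Field k] [CharP k p] [PerfectField k] ⦃Y : Scheme.{0}⦄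
    (f : Y ⟶ Spec (.of k)) [Smooth f] [IsSeparated f] [QuasiCompact f] (X : Y.IdealSheafData)
    (y : Y), IsBot (inv f X y) ↔
      ∀ x : X.subscheme, X.subschemeι x = y → IsRegularLocalRing (X.subscheme.presheaf.stalk x)
  /-- `(iii)` regular weighted centre -/
  isRegularWeightedCentre_centre : ∀ ⦃k : Type⦄ [Field k] [CharP k p] [PerfectField k]
    ⦃Y : Scheme.{0}⦄ (f : Y ⟶ Spec (.of k)) [Smooth f] [IsSeparated f] [QuasiCompact f]
    (X : Y.IdealSheafData), (∃ y : Y, ¬ IsBot (inv f X y)) →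
    (centre f X).IsRegularWeightedCentre
  /-- `(iii)` support = maximum locus -/
  support_centre : ∀ ⦃k : Type⦄ [Field k] [CharP k p] [PerfectField k]
    ⦃Y : Scheme.{0}⦄ (f : Y ⟶ Spec (.of k)) [Smooth f] [IsSeparated f] [QuasiCompact f]
    (X : Y.IdealSheafData), (∃ y : Y, ¬ IsBot (inv f X y)) →
    (centre f X).support = {y : Y | ∀ y' : Y, inv f X y' ≤ inv f X y}
  /-- `(i)` for the centre, smooth surjective `k`-morphisms -/
  centre_comap : ∀ ⦃k : Type⦄ [Field k] [CharP k p] [PerfectField k] ⦃Y Y₁ : Scheme.{0}⦄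
    (f : Y ⟶ Spec (.of k)) [Smooth f] [IsSeparated f] [QuasiCompact f]
    (f₁ : Y₁ ⟶ Spec (.of k)) [Smooth f₁] [IsSeparated f₁] [QuasiCompact f₁]
    (g : Y₁ ⟶ Y) [Smooth g] [Surjective g], g ≫ f = f₁ →
    ∀ (X : Y.IdealSheafData), (∃ y : Y, ¬ IsBot (inv f X y)) →
    ∀ n : ℕ, (centre f₁ (X.comap g)).piece n = ((centre f X).piece n).comap g
  /-- `(i)` for the centre, perfect ground-field extensions -/
  centre_baseChange : ∀ ⦃k : Type⦄ [Field k] [CharP k p] [PerfectField k]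
    ⦃K : Type⦄ [Field K] [PerfectField K] (φ : k →+* K)
    ⦃Y YK : Scheme.{0}⦄ (f : Y ⟶ Spec (.of k)) [Smooth f] [IsSeparated f] [QuasiCompact f]
    (fK : YK ⟶ Spec (.of K)) (pr : YK ⟶ Y),
    IsPullback pr fK f (Spec.map (CommRingCat.ofHom φ)) →
    ∀ (X : Y.IdealSheafData), (∃ y : Y, ¬ IsBot (inv f X y)) →
    ∀ n : ℕ, (centre fK (X.comap pr)).piece n = ((centre f X).piece n).comap pr
  /-- `(iv-ac-chart)` [guard] over an ALGEBRAICALLY CLOSED ground field, for every affine open `U` carrying a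
  weighted chart of the centre, with `B₊(U) → Spec k` smooth, separated and quasi-compact, at every CLOSED
  point `b` of `B₊(U)` on the exceptional divisor at which the strict transform is SINGULAR, `inv` of
  `(B₊(U), strict transform)` is strictly below `max_Y inv` -/
  inv_lt_of_chart : ∀ ⦃k : Type⦄ [Field k] [CharP k p] [PerfectField k] [IsAlgClosed k]
    ⦃Y : Scheme.{0}⦄ (f : Y ⟶ Spec (.of k)) [Smooth f] [IsSeparated f] [QuasiCompact f]
    (X : Y.IdealSheafData), (∃ y : Y, ¬ IsBot (inv f X y)) →
    ∀ (U : Y.affineOpens),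
      (∃ (m : ℕ) (u : Fin m → Γ(Y, U)) (w : Fin m → ℕ), (centre f X).IsWeightedChart U u w) →
      Smooth ((centre f X).cobordantPlusι U ≫ f) →
      IsSeparated ((centre f X).cobordantPlusι U ≫ f) →
      QuasiCompact ((centre f X).cobordantPlusι U ≫ f) →
      ∀ (b : (centre f X).cobordantPlus U), IsClosed ({b} : Set ((centre f X).cobordantPlus U)) →
        (affineCobordantBlowup.plusOpens ((centre f X).chartIdeals U)).ι b ∈
          ((affineCobordantBlowup.exceptional ((centre f X).chartIdeals U)).support :
            Set (affineCobordantBlowup ((centre f X).chartIdeals U))) →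
        (∃ x : ((centre f X).cobordantStrictTransform U X).subscheme,
          ((centre f X).cobordantStrictTransform U X).subschemeι x = b ∧
            ¬ IsRegularLocalRing (((centre f X).cobordantStrictTransform U X).subscheme.presheaf.stalk x)) →
        ∀ y : Y, (∀ y' : Y, inv f X y' ≤ inv f X y) →
          inv ((centre f X).cobordantPlusι U ≫ f) ((centre f X).cobordantStrictTransform U X) b
            < inv f X y

namespace ACChartPreDatum

variable {p : ℕ} (C : ACChartPreDatum p)

/-- The value set is linearly ordered. -/
instance instLinearOrder : LinearOrder C.Γ := C.linearOrder

/-- The value set is well-ordered. -/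
instance instWellFoundedLT : WellFoundedLT C.Γ := C.wellFoundedLT

/-- **Step 1 (charts ⇒ all affine opens, over an algebraically closed field, at singular closed exceptional
points)**: the chart-localisation argument of `ChartPreDatum.inv_lt_of_onExceptional`, with singularity of the
strict transform transported along the open immersion `B₊(D(h)) ↪ B₊(U)`
(`stub_singularLocus_comap_baseChange` (a)); the open pieces `B₊(D(h)) ↪ B₊(U)` are the hypothesis `HB` (the
statement of the landed `stub_cobordantPlus_basicOpen_openImmersion`, kept as a hypothesis while that module is
not built on the farm). -/
theorem inv_lt_alg
    (HB : ∀ ⦃Y : Scheme.{0}⦄ (R : ReesAlgebraData Y) (U : Y.affineOpens) (h : Γ(Y, U)) (X : Y.IdealSheafData), ∃ j : R.cobordantPlus (Y.affineBasicOpen h) ⟶ R.cobordantPlus U, IsOpenImmersion j ∧ j ≫ R.cobordantPlusι U = R.cobordantPlusι (Y.affineBasicOpen h) ∧ (R.cobordantStrictTransform U X).comap j = R.cobordantStrictTransform (Y.affineBasicOpen h) X ∧ (∀ b' : R.cobordantPlus (Y.affineBasicOpen h), (affineCobordantBlowup.plusOpens (R.chartIdeals U)).ι (j b') ∈ ((affineCobordantBlowup.exceptional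 (R.chartIdeals U)).support : Set (affineCobordantBlowup (R.chartIdeals U))) ↔ (affineCobordantBlowup.plusOpens (R.chartIdeals (Y.affineBasicOpen h))).ι b' ∈ ((affineCobordantBlowup.exceptional (R.chartIdeals (Y.affineBasicOpen h))).support : Set (affineCobordantBlowup (R.chartIdeals (Y.affineBasicOpen h))))) ∧ (∀ b : R.cobordantPlus U, R.cobordantPlusι U b ∈ Y.basicOpen h → ∃ b', j b' = b))
    {k : Type} [Field k] [CharP k p] [PerfectField k] [IsAlgClosed k]
    {Y : Scheme.{0}} (f : Y ⟶ Spec (.of k)) [Smooth f] [IsSeparated f] [QuasiCompact f]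
    (X : Y.IdealSheafData) (hguard : ∃ y : Y, ¬ IsBot (C.inv f X y)) (U : Y.affineOpens)
    (hsm : Smooth ((C.centre f X).cobordantPlusι U ≫ f))
    (hsep : IsSeparated ((C.centre f X).cobordantPlusι U ≫ f))
    (hqc : QuasiCompact ((C.centre f X).cobordantPlusι U ≫ f))
    (b : (C.centre f X).cobordantPlus U) (hbc : IsClosed ({b} : Set ((C.centre f X).cobordantPlus U)))
    (hb : (affineCobordantBlowup.plusOpens ((C.centre f X).chartIdeals U)).ι b ∈
      ((affineCobordantBlowup.exceptional ((C.centre f X).chartIdeals U)).support :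
        Set (affineCobordantBlowup ((C.centre f X).chartIdeals U))))
    (hsing : ∃ x : ((C.centre f X).cobordantStrictTransform U X).subscheme,
      ((C.centre f X).cobordantStrictTransform U X).subschemeι x = b ∧
        ¬ IsRegularLocalRing (((C.centre f X).cobordantStrictTransform U X).subscheme.presheaf.stalk x))
    (y : Y) (hy : ∀ y' : Y, C.inv f X y' ≤ C.inv f X y) :
    C.inv ((C.centre f X).cobordantPlusι U ≫ f) ((C.centre f X).cobordantStrictTransform U X) b
      < C.inv f X y := by
  have hRc : (C.centre f X).IsRegularWeightedCentre := C.isRegularWeightedCentre_centre f X hguard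
  -- the image point and a chart basic open around it
  have hy₀U : (C.centre f X).cobordantPlusι U b ∈ (U : Y.Opens) := by
    change (affineCobordantBlowup.plusπ ((C.centre f X).chartIdeals U) ≫ U.2.fromSpec) b ∈ (U : Y.Opens)
    rw [Scheme.Hom.comp_apply]
    exact U.2.range_fromSpec.le ⟨_, rfl⟩
  obtain ⟨U', hyU', m, u, w, hchart⟩ := hRc ((C.centre f X).cobordantPlusι U b)
  obtain ⟨h, h', heq, hyh⟩ := exists_basicOpen_le_affine_inter U.2 U'.2 _ ⟨hy₀U, hyU'⟩
  have hVU' : ((Y.affineBasicOpen h : Y.affineOpens) : Y.Opens) ≤ U' := by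
    change Y.basicOpen h ≤ (U' : Y.Opens)
    rw [heq]
    exact Y.basicOpen_le h'
  have hchartV := stub_isWeightedChart_of_le (C.centre f X) U' u w hchart (Y.affineBasicOpen h) hVU'
  -- the open piece `j : B₊(D(h)) → B₊(U)`
  obtain ⟨j, hjo, hjι, hjX, hjE, hjsurj⟩ := HB (C.centre f X) U h X
  obtain ⟨b', hb'⟩ := hjsurj b hyh
  haveI := hjo
  -- both charts are smooth, separated, quasi-compact over `k`
  obtain ⟨hsm', hsep', hqc'⟩ :=
    SupportFirst.stub_cobordantPlus_smooth f (C.centre f X) hRc (Y.affineBasicOpen h)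
  haveI := hsm; haveI := hsep; haveI := hqc; haveI := hsm'; haveI := hsep'; haveI := hqc'
  -- move the value along `j` by `(i)`
  have hcomp : j ≫ ((C.centre f X).cobordantPlusι U ≫ f) =
      (C.centre f X).cobordantPlusι (Y.affineBasicOpen h) ≫ f := by
    rw [← Category.assoc, hjι]
  have hval := C.inv_comap ((C.centre f X).cobordantPlusι U ≫ f)
    ((C.centre f X).cobordantPlusι (Y.affineBasicOpen h) ≫ f) j hcomp
    ((C.centre f X).cobordantStrictTransform U X) b'
  rw [hjX, hb'] at hval
  rw [← hval]
  -- closedness, exceptionality and singularity of `b'`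
  have hb'c : IsClosed ({b'} : Set ((C.centre f X).cobordantPlus (Y.affineBasicOpen h))) := by
    have hpre : ({b'} : Set ((C.centre f X).cobordantPlus (Y.affineBasicOpen h))) = j ⁻¹' {b} := by
      ext z
      simp only [Set.mem_singleton_iff, Set.mem_preimage]
      constructor
      · intro hz
        rw [hz, hb']
      · intro hz
        apply j.isOpenEmbedding.injective
        rw [hz, hb']
    rw [hpre]
    exact hbc.preimage j.continuous
  have hb'E : (affineCobordantBlowup.plusOpens ((C.centre f X).chartIdeals (Y.affineBasicOpen h))).ι b' ∈
      ((affineCobordantBlowup.exceptional ((C.centre f X).chartIdeals (Y.affineBasicOpen h))).support :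
        Set (affineCobordantBlowup ((C.centre f X).chartIdeals (Y.affineBasicOpen h)))) := by
    rw [← hjE b', hb']
    exact hb
  have hb'sing : ∃ x : ((C.centre f X).cobordantStrictTransform (Y.affineBasicOpen h) X).subscheme,
      ((C.centre f X).cobordantStrictTransform (Y.affineBasicOpen h) X).subschemeι x = b' ∧
        ¬ IsRegularLocalRing
          (((C.centre f X).cobordantStrictTransform (Y.affineBasicOpen h) X).subscheme.presheaf.stalk x) := by
    have key := (stub_singularLocus_comap_baseChange).1 ((C.centre f X).cobordantPlusι U ≫ f)
      ((C.centre f X).cobordantPlusι (Y.affineBasicOpen h) ≫ f) j hcomp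
      ((C.centre f X).cobordantStrictTransform U X) b'
    rw [hjX, hb'] at key
    exact key.mpr hsing
  exact C.inv_lt_of_chart f X hguard (Y.affineBasicOpen h) ⟨m, _, w, hchartV⟩ hsm' hsep' hqc' b'
    hb'c hb'E hb'sing y hy

/-- **Step 2 (algebraically closed ⇒ all perfect ground fields; singular ⇒ all closed exceptional points)**:
base change to an algebraic closure `K` of `k` — `Y_K → Y`, the centre and `inv` are compatible by `(i)`,
`B₊(U)_K = B₊(U_K)` with compatible strict transforms and exceptional divisors (`stub_cobordantPlus_baseChange`
∘ `stub_extReesAlgebra_baseChange`), a closed exceptional point lifts to a closed exceptional point of the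
fibre, singularity is invariant (`stub_singularLocus_comap_baseChange` (b)); at non-singular points `inv` is
minimal by `(ii)` and the maximum is not. -/
theorem inv_lt_of_onExceptional
    (HB : ∀ ⦃Y : Scheme.{0}⦄ (R : ReesAlgebraData Y) (U : Y.affineOpens) (h : Γ(Y, U)) (X : Y.IdealSheafData), ∃ j : R.cobordantPlus (Y.affineBasicOpen h) ⟶ R.cobordantPlus U, IsOpenImmersion j ∧ j ≫ R.cobordantPlusι U = R.cobordantPlusι (Y.affineBasicOpen h) ∧ (R.cobordantStrictTransform U X).comap j = R.cobordantStrictTransform (Y.affineBasicOpen h) X ∧ (∀ b' : R.cobordantPlus (Y.affineBasicOpen h), (affineCobordantBlowup.plusOpens (R.chartIdeals U)).ι (j b') ∈ ((affineCobordantBlowup.exceptional (R.chartIdeals U)).support : Set (affineCobordantBlowup (R.chartIdeals U))) ↔ (affineCobordantBlowup.plusOpens (R.chartIdeals (Y.affineBasicOpen h))).ι b' ∈ ((affineCobordantBlowup.exceptional (R.chartIdeals (Y.affineBasicOpen h))).support : Set (affineCobordantBlowup (R.chartIdeals (Y.affineBasicOpen h))))) ∧ (∀ b : R.cobordantPlus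 U, R.cobordantPlusι U b ∈ Y.basicOpen h → ∃ b', j b' = b)) :
    ∀ ⦃k : Type⦄ [Field k] [CharP k p] [PerfectField k] ⦃Y : Scheme.{0}⦄ (f : Y ⟶ Spec (.of k))
      [Smooth f] [IsSeparated f] [QuasiCompact f] (X : Y.IdealSheafData),
      (∃ y : Y, ¬ IsBot (C.inv f X y)) →
      ∀ (U : Y.affineOpens), Smooth ((C.centre f X).cobordantPlusι U ≫ f) →
        IsSeparated ((C.centre f X).cobordantPlusι U ≫ f) →
        QuasiCompact ((C.centre f X).cobordantPlusι U ≫ f) →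
        ∀ (b : (C.centre f X).cobordantPlus U), IsClosed ({b} : Set ((C.centre f X).cobordantPlus U)) →
          (affineCobordantBlowup.plusOpens ((C.centre f X).chartIdeals U)).ι b ∈
            ((affineCobordantBlowup.exceptional ((C.centre f X).chartIdeals U)).support :
              Set (affineCobordantBlowup ((C.centre f X).chartIdeals U))) →
          ∀ y : Y, (∀ y' : Y, C.inv f X y' ≤ C.inv f X y) →
            C.inv ((C.centre f X).cobordantPlusι U ≫ f) ((C.centre f X).cobordantStrictTransform U X) b
              < C.inv f X y := by
  intro k _ _ _ Y f _ _ _ X hguard U hsm hsep hqc b hbc hb y hy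
  -- the maximum is not minimal
  have hymax : ¬ IsBot (C.inv f X y) := by
    obtain ⟨y₀, hy₀⟩ := hguard
    exact fun hbot => hy₀ fun γ => (hy y₀).trans (hbot γ)
  haveI := hsm; haveI := hsep; haveI := hqc
  by_cases hsing : ∃ x : ((C.centre f X).cobordantStrictTransform U X).subscheme,
      ((C.centre f X).cobordantStrictTransform U X).subschemeι x = b ∧
        ¬ IsRegularLocalRing (((C.centre f X).cobordantStrictTransform U X).subscheme.presheaf.stalk x)
  swap
  · -- the strict transform is regular or absent at `b`: `inv` is minimal there by `(ii)`
    have hbot : IsBot (C.inv ((C.centre f X).cobordantPlusι U ≫ f)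
        ((C.centre f X).cobordantStrictTransform U X) b) := by
      rw [C.isBot_inv_iff ((C.centre f X).cobordantPlusι U ≫ f) _ b]
      intro x hx
      by_contra hreg
      exact hsing ⟨x, hx, hreg⟩
    exact lt_of_le_of_ne (hbot _) fun heq => hymax (heq ▸ hbot)
  · -- base change to an algebraic closure `K` of `k`
    let K : Type := AlgebraicClosure k
    let φ : k →+* K := algebraMap k K
    let g : Spec (.of K) ⟶ Spec (.of k) := Spec.map (CommRingCat.ofHom φ)
    let YK : Scheme.{0} := Limits.pullback f g
    let pr : YK ⟶ Y := Limits.pullback.fst f g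
    let fK : YK ⟶ Spec (.of K) := Limits.pullback.snd f g
    have hpb : IsPullback pr fK f g := IsPullback.of_hasPullback f g
    haveI : Smooth fK := inferInstance
    haveI : IsSeparated fK := MorphismProperty.pullback_snd _ _ inferInstance
    haveI : QuasiCompact fK := MorphismProperty.pullback_snd _ _ inferInstance
    haveI : Surjective g := (CobordantPlusBaseChange.flat_and_surjective_SpecMap_of_field φ).2
    haveI : Surjective pr := MorphismProperty.pullback_fst _ _ inferInstance
    haveI : IsAffineHom g := inferInstance
    haveI : IsAffineHom pr := MorphismProperty.pullback_fst _ _ inferInstance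
    -- `inv` and the centre are compatible with the base change `(i)`
    have hinvY : ∀ y' : YK, C.inv fK (X.comap pr) y' = C.inv f X (pr y') :=
      C.inv_baseChange φ f fK pr hpb X
    have hguardK : ∃ y' : YK, ¬ IsBot (C.inv fK (X.comap pr) y') := by
      obtain ⟨y₀, hy₀⟩ := hguard
      obtain ⟨y₀', rfl⟩ := pr.surjective y₀
      exact ⟨y₀', by rwa [hinvY]⟩
    have hRK : ∀ n, (C.centre fK (X.comap pr)).piece n = ((C.centre f X).piece n).comap pr :=
      C.centre_baseChange φ f fK pr hpb X hguard
    let UK : YK.affineOpens := ⟨pr ⁻¹ᵁ (U : Y.Opens), U.2.preimage pr⟩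
    -- the base change `prB : B₊(U_K) → B₊(U)` of the cobordant chart
    obtain ⟨prB, hpbB, -, hXB, hEB, hsurjB⟩ :=
      stub_cobordantPlus_baseChange (fun I I' hI' => stub_extReesAlgebra_baseChange I I' hI') φ f fK pr
        hpb (C.centre f X) (C.centre fK (X.comap pr)) hRK U UK rfl X
    obtain ⟨hsmK, hsepK, hqcK⟩ := SupportFirst.stub_cobordantPlus_smooth fK (C.centre fK (X.comap pr))
      (C.isRegularWeightedCentre_centre fK (X.comap pr) hguardK) UK
    haveI := hsmK; haveI := hsepK; haveI := hqcK
    -- a CLOSED point `b'` of the fibre of `prB` over `b`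
    haveI : CompactSpace ((C.centre fK (X.comap pr)).cobordantPlus UK) :=
      QuasiCompact.compactSpace_of_compactSpace ((C.centre fK (X.comap pr)).cobordantPlusι UK ≫ fK)
    obtain ⟨b', hb'mem, hb'c⟩ := (hbc.preimage prB.continuous).exists_closed_singleton
      (by obtain ⟨b', hb'⟩ := hsurjB b; exact ⟨b', hb'⟩)
    have hb' : prB b' = b := hb'mem
    -- the value at `b` is the value at `b'`
    have hval := C.inv_baseChange φ ((C.centre f X).cobordantPlusι U ≫ f)
      ((C.centre fK (X.comap pr)).cobordantPlusι UK ≫ fK) prB hpbB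
      ((C.centre f X).cobordantStrictTransform U X) b'
    rw [hXB, hb'] at hval
    rw [← hval]
    -- a maximum point upstairs
    obtain ⟨yK, hyK⟩ := pr.surjective y
    have hyval : C.inv f X y = C.inv fK (X.comap pr) yK := by rw [hinvY, hyK]
    have hyKmax : ∀ y' : YK, C.inv fK (X.comap pr) y' ≤ C.inv fK (X.comap pr) yK := fun y' => by
      rw [hinvY, hinvY, hyK]
      exact hy _
    rw [hyval]
    -- exceptionality and singularity of `b'`
    have hb'E := (hEB b').mp (by rw [hb']; exact hb)
    have hb'sing : ∃ x : ((C.centre fK (X.comap pr)).cobordantStrictTransform UK (X.comap pr)).subscheme,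
        ((C.centre fK (X.comap pr)).cobordantStrictTransform UK (X.comap pr)).subschemeι x = b' ∧
          ¬ IsRegularLocalRing
            (((C.centre fK (X.comap pr)).cobordantStrictTransform UK (X.comap pr)).subscheme.presheaf.stalk
              x) := by
      have key := (stub_singularLocus_comap_baseChange).2 φ ((C.centre f X).cobordantPlusι U ≫ f)
        ((C.centre fK (X.comap pr)).cobordantPlusι UK ≫ fK) prB hpbB
        ((C.centre f X).cobordantStrictTransform U X) b'
      rw [hXB, hb'] at key
      exact key.mpr hsing
    exact C.inv_lt_alg HB fK (X.comap pr) hguardK UK hsmK hsepK hqcK b' hb'c hb'E hb'sing yK hyKmax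

/-- **Every pre-datum is an algebraically-closed chart pre-datum** (forget the extra generality of its drop
axiom). -/
def ofPreDatum (P : PreDatum p) : ACChartPreDatum p where
  Γ := P.Γ
  inv := P.inv
  centre := P.centre
  isClosed_superlevel := P.isClosed_superlevel
  inv_comap := P.inv_comap
  inv_baseChange := P.inv_baseChange
  isBot_inv_iff := P.isBot_inv_iff
  isRegularWeightedCentre_centre := P.isRegularWeightedCentre_centre
  support_centre := P.support_centre
  centre_comap := P.centre_comap
  centre_baseChange := P.centre_baseChange
  inv_lt_of_chart := fun _ _ _ _ _ _ f _ _ _ X hguard U _ hsm hsep hqc b hbc hb _ y hy =>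
    P.inv_lt_of_onExceptional f X hguard U hsm hsep hqc b hbc hb y hy

end ACChartPreDatum

/-- **Algebraically-closed chart pre-datum ⇒ pre-datum, conditional form** (registered stub
`stub_acChartPreDatum_toPreDatum_of`): granted the open pieces `B₊(D(h)) ↪ B₊(U)` (the statement of the landed
`stub_cobordantPlus_basicOpen_openImmersion`), an algebraically-closed chart pre-datum in characteristic `p`
yields a pre-datum with the same `Γ`, `inv` and `centre`. -/
theorem stub_acChartPreDatum_toPreDatum_of :
    (∀ ⦃Y : Scheme.{0}⦄ (R : ReesAlgebraData Y) (U : Y.affineOpens) (h : Γ(Y, U)) (X : Y.IdealSheafData), ∃ j : R.cobordantPlus (Y.affineBasicOpen h) ⟶ R.cobordantPlus U, IsOpenImmersion j ∧ j ≫ R.cobordantPlusι U = R.cobordantPlusι (Y.affineBasicOpen h) ∧ (R.cobordantStrictTransform U X).comap j = R.cobordantStrictTransform (Y.affineBasicOpen h) X ∧ (∀ b' : R.cobordantPlus (Y.affineBasicOpen h), (affineCobordantBlowup.plusOpens (R.chartIdeals U)).ι (j b') ∈ ((affineCobordantBlowup.exceptional (R.chartIdeals U)).support : Set (affineCobordantBlowup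 (R.chartIdeals U))) ↔ (affineCobordantBlowup.plusOpens (R.chartIdeals (Y.affineBasicOpen h))).ι b' ∈ ((affineCobordantBlowup.exceptional (R.chartIdeals (Y.affineBasicOpen h))).support : Set (affineCobordantBlowup (R.chartIdeals (Y.affineBasicOpen h))))) ∧ (∀ b : R.cobordantPlus U, R.cobordantPlusι U b ∈ Y.basicOpen h → ∃ b', j b' = b)) →
    ∀ p : ℕ, Nonempty (ACChartPreDatum p) → Nonempty (PreDatum p) := by
  rintro HB p ⟨C⟩
  exact ⟨{ Γ := C.Γ
           inv := C.inv
           centre := C.centre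
           isClosed_superlevel := C.isClosed_superlevel
           inv_comap := C.inv_comap
           inv_baseChange := C.inv_baseChange
           isBot_inv_iff := C.isBot_inv_iff
           isRegularWeightedCentre_centre := C.isRegularWeightedCentre_centre
           support_centre := C.support_centre
           centre_comap := C.centre_comap
           centre_baseChange := C.centre_baseChange
           inv_lt_of_onExceptional := C.inv_lt_of_onExceptional HB }⟩

end Summit.ResolutionOfSingularities.ResolutionOfSingularities.Theorems

end
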